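import Summits.FinalStateConjecture.FinalStateConjecture.Theorems.EIHFluxBalanceInertialRecessionStubRechart3InverseFrame
import Summits.FinalStateConjecture.FinalStateConjecture.Theorems.EIHFluxBalanceInertialRecessionSlavingSpatialRigidity

/-!
# Route EIHFluxBalance — `InertialRecession` (E′), stub `stub_frozenVacuumSlaving` (K1): the lab first
# variation of the painted summand is (minus) the rest-frame Lie derivative along the BODY rates

Helper file for the crux `stmt-FinalStateConjecture-17403`. For a motion `s ↦ (Λ s, c s)` with operator
derivative `Λ′` and `c′` at `s₀`, body rate `A := Λ₀⁻¹ ∘ Λ′` (an `η`-skew operator of the rest frame) and rest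
translation rate `d := Λ₀⁻¹ c′`, and a lab point `x` with rest point `y = Λ₀⁻¹(x − c₀)` of positive Kerr–Schild
radius: for all lab vectors `v, w` with rest images `V = Λ₀⁻¹ v`, `W = Λ₀⁻¹ w`,
`d/ds|_{s₀} boostedKerrBilin (Λ s) (c s) M a x v w = −(∂_{Ay+d} g(y)(V, W) + g(y)(AV, W) + g(y)(V, AW))`,
`g = Kerr.bilin M a` (`hasDerivAt_boostedKerrBilin_eq_neg_lie`). This is the bridge from the lab-frame jets of the
slaving stub to the rest-frame kernel lemma `axisKernel_three_points` (`…SlavingAxisKernel`); `A` is `η`-skew by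
`skew_bodyRate`. Literature + Mathlib (`hasFDerivAt_ringInverse`) only; no definitions, no `sorry`. [folklore]
-/

set_option linter.dupNamespace false

noncomputable section

open scoped Topology
open Filter Set Function Literature.Geometry.Lorentzian Literature.Geometry.Lorentzian.Kerr
  Summit.FinalStateConjecture.FinalStateConjecture.Theorems.SublinearIsFree.Rechart

namespace Summit.FinalStateConjecture.FinalStateConjecture.Theorems.SublinearIsFree.Slaving

section Path

variable {Λ : ℝ → lorentzGroup} {c : ℝ → E4} {s₀ : ℝ} {Λ' : E4 →L[ℝ] E4} {c' : E4}

/-- **The inverse frame path has derivative `−Λ₀⁻¹ Λ′ Λ₀⁻¹`.** [folklore] -/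
theorem hasDerivAt_lorentz_symm (hΛ : HasDerivAt (fun s ↦ ((Λ s : E4 ≃L[ℝ] E4) : E4 →L[ℝ] E4)) Λ' s₀) :
    HasDerivAt (fun s ↦ (((Λ s : E4 ≃L[ℝ] E4).symm : E4 ≃L[ℝ] E4) : E4 →L[ℝ] E4))
      (-((((Λ s₀ : E4 ≃L[ℝ] E4).symm : E4 ≃L[ℝ] E4) : E4 →L[ℝ] E4).comp
        (Λ'.comp (((Λ s₀ : E4 ≃L[ℝ] E4).symm : E4 ≃L[ℝ] E4) : E4 →L[ℝ] E4)))) s₀ := by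
  rw [lorentz_symm_eq_ring_inverse Λ]
  have hu : IsUnit ((Λ s₀ : E4 ≃L[ℝ] E4) : E4 →L[ℝ] E4) := isUnit_of_minkowski_invariant (Λ s₀).2
  have h := (hasFDerivAt_ringInverse (𝕜 := ℝ) hu.unit)
  rw [IsUnit.unit_spec] at h
  have h2 := h.comp_hasDerivAt s₀ hΛ
  have hinv : (↑(hu.unit⁻¹) : E4 →L[ℝ] E4) = (((Λ s₀ : E4 ≃L[ℝ] E4).symm : E4 ≃L[ℝ] E4) : E4 →L[ℝ] E4) := by
    rw [← Ring.inverse_unit, IsUnit.unit_spec, ring_inverse_lorentz]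
  refine h2.congr_deriv ?_
  ext v
  simp [hinv]

/-- **The body rate `A = Λ₀⁻¹Λ′` is `η`-skew** (differentiate `η(Λ(s)p, Λ(s)q) = η(p, q)` and transport by
`Λ₀⁻¹`; O'Neill 1983, Ch. 9). [folklore] -/
theorem skew_bodyRate (hΛ : HasDerivAt (fun s ↦ ((Λ s : E4 ≃L[ℝ] E4) : E4 →L[ℝ] E4)) Λ' s₀) (p q : E4) :
    Minkowski.bilin ((((Λ s₀ : E4 ≃L[ℝ] E4).symm : E4 ≃L[ℝ] E4) : E4 →L[ℝ] E4) (Λ' p)) q +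
      Minkowski.bilin p ((((Λ s₀ : E4 ≃L[ℝ] E4).symm : E4 ≃L[ℝ] E4) : E4 →L[ℝ] E4) (Λ' q)) = 0 := by
  -- s ↦ η(Λ(s)p, Λ(s)q) is constant
  have hconst : (fun s ↦ Minkowski.bilin (((Λ s : E4 ≃L[ℝ] E4) : E4 →L[ℝ] E4) p)
      (((Λ s : E4 ≃L[ℝ] E4) : E4 →L[ℝ] E4) q)) = fun _ ↦ Minkowski.bilin p q :=
    funext fun s ↦ (Λ s).2 p q
  have hp : HasDerivAt (fun s ↦ ((Λ s : E4 ≃L[ℝ] E4) : E4 →L[ℝ] E4) p) (Λ' p) s₀ := by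
    simpa using hΛ.clm_apply (hasDerivAt_const s₀ p)
  have hq : HasDerivAt (fun s ↦ ((Λ s : E4 ≃L[ℝ] E4) : E4 →L[ℝ] E4) q) (Λ' q) s₀ := by
    simpa using hΛ.clm_apply (hasDerivAt_const s₀ q)
  have hb : HasDerivAt (fun s ↦ Minkowski.bilin (((Λ s : E4 ≃L[ℝ] E4) : E4 →L[ℝ] E4) p))
      (Minkowski.bilin (Λ' p)) s₀ := Minkowski.bilin.hasFDerivAt.comp_hasDerivAt s₀ hp
  have hder : HasDerivAt (fun s ↦ Minkowski.bilin (((Λ s : E4 ≃L[ℝ] E4) : E4 →L[ℝ] E4) p)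
      (((Λ s : E4 ≃L[ℝ] E4) : E4 →L[ℝ] E4) q))
      (Minkowski.bilin (Λ' p) (((Λ s₀ : E4 ≃L[ℝ] E4) : E4 →L[ℝ] E4) q) +
        Minkowski.bilin (((Λ s₀ : E4 ≃L[ℝ] E4) : E4 →L[ℝ] E4) p) (Λ' q)) s₀ := hb.clm_apply hq
  have hzero : Minkowski.bilin (Λ' p) (((Λ s₀ : E4 ≃L[ℝ] E4) : E4 →L[ℝ] E4) q) +
      Minkowski.bilin (((Λ s₀ : E4 ≃L[ℝ] E4) : E4 →L[ℝ] E4) p) (Λ' q) = 0 := by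
    have h0 : HasDerivAt (fun s ↦ Minkowski.bilin (((Λ s : E4 ≃L[ℝ] E4) : E4 →L[ℝ] E4) p)
        (((Λ s : E4 ≃L[ℝ] E4) : E4 →L[ℝ] E4) q)) 0 s₀ := by
      rw [hconst]; exact hasDerivAt_const _ _
    exact hder.unique h0
  -- transport by Λ₀⁻¹: η(Λ'p, Λ₀q) = η(Λ₀⁻¹Λ'p, q)
  have t1 : Minkowski.bilin (Λ' p) (((Λ s₀ : E4 ≃L[ℝ] E4) : E4 →L[ℝ] E4) q) =
      Minkowski.bilin ((((Λ s₀ : E4 ≃L[ℝ] E4).symm : E4 ≃L[ℝ] E4) : E4 →L[ℝ] E4) (Λ' p)) q := by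
    have h := (Λ s₀).2 ((Λ s₀ : E4 ≃L[ℝ] E4).symm (Λ' p)) q
    rw [ContinuousLinearEquiv.apply_symm_apply] at h
    exact h
  have t2 : Minkowski.bilin (((Λ s₀ : E4 ≃L[ℝ] E4) : E4 →L[ℝ] E4) p) (Λ' q) =
      Minkowski.bilin p ((((Λ s₀ : E4 ≃L[ℝ] E4).symm : E4 ≃L[ℝ] E4) : E4 →L[ℝ] E4) (Λ' q)) := by
    have h := (Λ s₀).2 p ((Λ s₀ : E4 ≃L[ℝ] E4).symm (Λ' q))
    rw [ContinuousLinearEquiv.apply_symm_apply] at h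
    exact h
  rw [← t1, ← t2]; exact hzero

/-- **The lab first variation is minus the rest-frame Lie derivative along the body rates.** See the module
docstring. [folklore] -/
theorem hasDerivAt_boostedKerrBilin_eq_neg_lie
    (hΛ : HasDerivAt (fun s ↦ ((Λ s : E4 ≃L[ℝ] E4) : E4 →L[ℝ] E4)) Λ' s₀) (hc : HasDerivAt c c' s₀)
    {M a : ℝ} {x : E4} (hx : 0 < Kerr.radius a (poincareInv (Λ s₀) (c s₀) x)) (v w : E4) :
    HasDerivAt (fun s ↦ boostedKerrBilin (Λ s) (c s) M a x v w)
      (-(fderiv ℝ (Kerr.bilin M a) (poincareInv (Λ s₀) (c s₀) x)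
          ((((Λ s₀ : E4 ≃L[ℝ] E4).symm : E4 ≃L[ℝ] E4) : E4 →L[ℝ] E4) (Λ' (poincareInv (Λ s₀) (c s₀) x)) +
            (((Λ s₀ : E4 ≃L[ℝ] E4).symm : E4 ≃L[ℝ] E4) : E4 →L[ℝ] E4) c')
          ((Λ s₀ : E4 ≃L[ℝ] E4).symm v) ((Λ s₀ : E4 ≃L[ℝ] E4).symm w) +
        Kerr.bilin M a (poincareInv (Λ s₀) (c s₀) x)
          ((((Λ s₀ : E4 ≃L[ℝ] E4).symm : E4 ≃L[ℝ] E4) : E4 →L[ℝ] E4) (Λ' ((Λ s₀ : E4 ≃L[ℝ] E4).symm v)))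
          ((Λ s₀ : E4 ≃L[ℝ] E4).symm w) +
        Kerr.bilin M a (poincareInv (Λ s₀) (c s₀) x) ((Λ s₀ : E4 ≃L[ℝ] E4).symm v)
          ((((Λ s₀ : E4 ≃L[ℝ] E4).symm : E4 ≃L[ℝ] E4) : E4 →L[ℝ] E4) (Λ' ((Λ s₀ : E4 ≃L[ℝ] E4).symm w))))) s₀ := by
  set Li : ℝ → E4 →L[ℝ] E4 := fun s ↦ (((Λ s : E4 ≃L[ℝ] E4).symm : E4 ≃L[ℝ] E4) : E4 →L[ℝ] E4) with hLidef
  set L0 : E4 →L[ℝ] E4 := Li s₀ with hL0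
  set y : ℝ → E4 := fun s ↦ poincareInv (Λ s) (c s) x with hy
  have hLi : HasDerivAt Li (-(L0.comp (Λ'.comp L0))) s₀ := hasDerivAt_lorentz_symm hΛ
  -- the rest point and the transported vectors
  have hyd : HasDerivAt y (-(L0 (Λ' (y s₀)) + L0 c')) s₀ := by
    have h : y = fun s ↦ Li s (x - c s) := rfl
    rw [h]
    have := hLi.clm_apply ((hasDerivAt_const s₀ x).sub hc)
    refine this.congr_deriv ?_
    simp only [zero_sub, map_neg, neg_add]
    rfl
  have hp : HasDerivAt (fun s ↦ Li s v) (-(L0 (Λ' (L0 v)))) s₀ := by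
    have := hLi.clm_apply (hasDerivAt_const s₀ v)
    refine this.congr_deriv ?_
    simp [ContinuousLinearMap.comp_apply]
  have hq : HasDerivAt (fun s ↦ Li s w) (-(L0 (Λ' (L0 w)))) s₀ := by
    have := hLi.clm_apply (hasDerivAt_const s₀ w)
    refine this.congr_deriv ?_
    simp [ContinuousLinearMap.comp_apply]
  -- the Kerr–Schild form along the rest point
  have hd : DifferentiableAt ℝ (Kerr.bilin M a) (y s₀) :=
    (Kerr.contDiffAt_bilin M a hx (n := 1)).differentiableAt one_ne_zero
  have hB : HasDerivAt (fun s ↦ Kerr.bilin M a (y s))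
      (fderiv ℝ (Kerr.bilin M a) (y s₀) (-(L0 (Λ' (y s₀)) + L0 c'))) s₀ :=
    HasFDerivAt.comp_hasDerivAt (l := Kerr.bilin M a) s₀ hd.hasFDerivAt hyd
  have hall := (hB.clm_apply hp).clm_apply hq
  have hfun : (fun s ↦ boostedKerrBilin (Λ s) (c s) M a x v w) = fun s ↦ Kerr.bilin M a (y s) (Li s v) (Li s w) :=
    funext fun s ↦ boostedKerrBilin_apply (Λ s) (c s) M a x v w
  rw [hfun]
  refine hall.congr_deriv ?_
  simp only [hy, hL0, hLidef, map_neg, map_add]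
  simp
  ring

end Path

/-- Registered carrier `slaving_covariance_slaving12` of the crux item (= `skew_bodyRate`). [folklore] -/
theorem slaving_covariance_slaving12 : open Literature.Geometry.Lorentzian in ∀ {Λ : ℝ → lorentzGroup} {s₀ : ℝ} {Λ' : E4 →L[ℝ] E4}, HasDerivAt (fun s ↦ ((Λ s : E4 ≃L[ℝ] E4) : E4 →L[ℝ] E4)) Λ' s₀ → ∀ p q : E4, Minkowski.bilin ((((Λ s₀ : E4 ≃L[ℝ] E4).symm : E4 ≃L[ℝ] E4) : E4 →L[ℝ] E4) (Λ' p)) q + Minkowski.bilin p ((((Λ s₀ : E4 ≃L[ℝ] E4).symm : E4 ≃L[ℝ] E4) : E4 →L[ℝ] E4) (Λ' q)) = 0 :=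
  fun hΛ p q ↦ skew_bodyRate hΛ p q

end Summit.FinalStateConjecture.FinalStateConjecture.Theorems.SublinearIsFree.Slaving
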